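import Mathlib
import HarnessLib
import Summits.HubbardSuperconductivity.HubbardSuperconductivity.Theorems.KLProgrammeC4aKernelBumpRows

/-!
# Route `KLProgramme` — crux C4a, S3 brick (B4) «(U1)-HYBRID», «SWAP-BY-SYMMETRY» part 6: the three kernel rows of the COMPARABLE-LEVELS laws (`…Middle`:
# `hcomp`, `hKopp`, `hflatB`) for the bumped family `χ(u)·Kr(e,u)/C`

Cell `gate-hubbard-kl`, seat hubbard-kl-k3c3-p3 (g38; row «implicit-function / monotonicity route for μ(n)»).  Companion of `…C4aKernelBumpRows` / `…Weighted` (U7's rows)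
for U7-M `…C4aUmkLoopCircleCanonicalMiddle.umkLoopCircle_integral_middle_le_canonical` (kernel rows l.93–97), asked by k3c3-p1 g19 (KL STATUS 2026-08-29 18:53Z) for the
`χ·M_s` re-key; memo HOME/hubbard-kl-k3c3-p3/SWAP-BY-SYMMETRY.md §3.
Bump as in part 3: `χ ∈ C²`, `|χ| ≤ 1`, `|χ′| ≤ B₁`, `χ′ = 0` on `|u| ≥ R` and on `|u| ≤ r`, `lo ≤ hi ≤ R`, normalisation `1 ≤ C` (any `C ≥ 1 + 2B₁R + B₂R²` of part 3 will do).
* **`bumpKernel_hcomp`** — `(χ·Kr/C)′ = 0` on `q_c·e ≤ |u|` from the derivative row `hcomp` AND the value vanishing `hcomp0 : q_c·e ≤ |u| → Kr e u = 0` (the comparable piece's support;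
  k3c3-p1's `ppMidKernelS_eq_zero_of_scale_le_*`);
* **`bumpKernel_hKopp`** — the opposite-sign derivative row with `Ct ↦ (Ct + B₁·R·Cv)/C`, given a VALUE row of the same shape on the bump's transition zone
  `hKopp0 : u ≤ −e/4 → |u| < R → |Kr e u| ≤ Cv·lo·(max e |u|)⁻¹²` (kernel side: thermal smallness of `M_s` at opposite signs, or `Cv = 0` where it vanishes);
* **`bumpKernel_hflatB`** — the windowed flatness row from the flatness of `Kr` AT THE MODIFIED WEIGHT `wt·χ(D − ·)` on the same `D`-window
  `[max lo (D/(q_c+3/2)), min hi (4D)]` plus the value-envelope term: `Afl ↦ Afl/C`, `Bfl ↦ (Bfl + W·B₁·r⁻¹·hi)/C`, under `Dfl ≤ (q_c + 3/2)·hi` (true for the MidS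
  bundle's `q_c = 2(2−t₁)/t₁`, `Dfl = hi/t₁`) so that the window stays inside `(0, hi]`.
Pure one-variable calculus; nothing about the model; nothing asserts (C), K3, the window or superconductivity.
References: BGM 2006 §2.4 (2.36) [cite: BenfattoGiulianiMastropietro2006]; FST II CPAM 51 (1998) §3 [cite: FeldmanSalmhoferTrubowitz1998].
-/

noncomputable section

namespace Summit.HubbardSuperconductivity.HubbardSuperconductivity.Theorems.C4a

set_option linter.dupNamespace false -- summit = problem name (single-conjunct summit), D-0017

open Real Set Filter MeasureTheory intervalIntegral
open scoped Topology Interval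

section Middle

variable {χ : ℝ → ℝ} (hχ : ContDiff ℝ 2 χ) {Bχ₁ Rχ rχ : ℝ} (hχ0 : ∀ u, |χ u| ≤ 1) (hχ1 : ∀ u, |deriv χ u| ≤ Bχ₁)
  (hχ1z : ∀ u, Rχ ≤ |u| → deriv χ u = 0) (hχ1r : ∀ u, |u| ≤ rχ → deriv χ u = 0) (hrχ : 0 < rχ)
  {Kr : ℝ → ℝ → ℝ} {lo hi C : ℝ} (hlo : 0 < lo) (hlohi : lo ≤ hi) (hhiR : hi ≤ Rχ) (hC1 : 1 ≤ C)

include hχ in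
/-- **Row `hcomp`** (the comparable piece dies beyond `q_c·e`) transfers from the derivative row and the VALUE vanishing. -/
theorem bumpKernel_hcomp {qc : ℝ} (hKd : ∀ e ∈ Icc (-hi) hi, ContDiff ℝ 1 (Kr e))
    (hcomp0 : ∀ e ∈ Icc lo hi, ∀ u, qc * e ≤ |u| → Kr e u = 0) (hcomp : ∀ e ∈ Icc lo hi, ∀ u, qc * e ≤ |u| → deriv (Kr e) u = 0)
    (hlo : 0 < lo) :
    ∀ e ∈ Icc lo hi, ∀ u, qc * e ≤ |u| → deriv (fun v => χ v * Kr e v / C) u = 0 := fun e he u hu => by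
  have he' : e ∈ Icc (-hi) hi := ⟨by linarith [he.1, he.2], he.2⟩
  rw [deriv_bumpKernel (hχ.differentiable (by norm_num)) ((hKd e he').differentiable one_ne_zero), hcomp0 e he u hu, hcomp e he u hu]
  simp

include hχ hχ0 hχ1 hχ1z hlo hlohi hhiR hC1 in
/-- **Row `hKopp`** (opposite-sign partner: derivative `∝ lo`) transfers with `Ct ↦ (Ct + B₁·R·Cv)/C`, given a value row of the same shape on `|u| < R`. -/
theorem bumpKernel_hKopp {Ct Cv : ℝ} (hCv : 0 ≤ Cv) (hKd : ∀ e ∈ Icc (-hi) hi, ContDiff ℝ 1 (Kr e))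
    (hKopp : ∀ e ∈ Icc lo hi, ∀ u, u ≤ -(e / 4) → |deriv (Kr e) u| ≤ Ct * lo * (max e |u|)⁻¹ ^ 3)
    (hKopp0 : ∀ e ∈ Icc lo hi, ∀ u, u ≤ -(e / 4) → |u| < Rχ → |Kr e u| ≤ Cv * lo * (max e |u|)⁻¹ ^ 2) :
    ∀ e ∈ Icc lo hi, ∀ u, u ≤ -(e / 4) → |deriv (fun v => χ v * Kr e v / C) u| ≤ (Ct + Bχ₁ * Rχ * Cv) / C * lo * (max e |u|)⁻¹ ^ 3 :=
  fun e he u hu => by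
  have hχd : Differentiable ℝ χ := hχ.differentiable (by norm_num)
  have hC0 : 0 < C := by linarith
  have hB1 : 0 ≤ Bχ₁ := (abs_nonneg _).trans (hχ1 0)
  have hR : 0 ≤ Rχ := (hlo.le.trans hlohi).trans hhiR
  have he0 : 0 < e := hlo.trans_le he.1
  have he' : e ∈ Icc (-hi) hi := ⟨by linarith [he.1, he.2], he.2⟩
  have hm : 0 < max e |u| := lt_max_of_lt_left he0
  rw [deriv_bumpKernel hχd ((hKd e he').differentiable one_ne_zero), abs_div, abs_of_pos hC0,
    show (Ct + Bχ₁ * Rχ * Cv) / C * lo * (max e |u|)⁻¹ ^ 3 = ((Ct + Bχ₁ * Rχ * Cv) * lo * (max e |u|)⁻¹ ^ 3) / C by ring]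
  refine div_le_div_of_nonneg_right ?_ hC0.le
  have hA : |deriv χ u * Kr e u| ≤ Bχ₁ * Rχ * Cv * lo * (max e |u|)⁻¹ ^ 3 := by
    by_cases hur : Rχ ≤ |u|
    · rw [hχ1z u hur, zero_mul, abs_zero]; positivity
    · push Not at hur
      have hmR : max e |u| ≤ Rχ := max_le (he.2.trans hhiR) hur.le
      rw [abs_mul]
      calc |deriv χ u| * |Kr e u| ≤ Bχ₁ * (Cv * lo * (max e |u|)⁻¹ ^ 2) := mul_le_mul (hχ1 u) (hKopp0 e he u hu hur) (abs_nonneg _) hB1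
        _ ≤ Bχ₁ * (Cv * lo * (Rχ * (max e |u|)⁻¹ ^ 3)) := by
            refine mul_le_mul_of_nonneg_left (mul_le_mul_of_nonneg_left (inv_sq_le_mul_inv_cube hm hmR).1 (mul_nonneg hCv hlo.le)) hB1
        _ = _ := by ring
  have hB : |χ u * deriv (Kr e) u| ≤ 1 * (Ct * lo * (max e |u|)⁻¹ ^ 3) := by
    rw [abs_mul]; exact mul_le_mul (hχ0 u) (hKopp e he u hu) (abs_nonneg _) zero_le_one
  calc |deriv χ u * Kr e u + χ u * deriv (Kr e) u| ≤ Bχ₁ * Rχ * Cv * lo * (max e |u|)⁻¹ ^ 3 + 1 * (Ct * lo * (max e |u|)⁻¹ ^ 3) :=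
        (abs_add_le _ _).trans (add_le_add hA hB)
    _ = (Ct + Bχ₁ * Rχ * Cv) * lo * (max e |u|)⁻¹ ^ 3 := by ring

include hχ hχ1 hχ1r hrχ hlo hlohi hC1 in
/-- **Row `hflatB`** (windowed flatness of the comparable piece) transfers: given the flatness of `Kr` AT THE MODIFIED WEIGHT `wt·χ(D − ·)` on the same `D`-window and
the value envelope `hK0`, the bumped family is flat on the window with `Afl ↦ Afl/C`, `Bfl ↦ (Bfl + W·B₁·r⁻¹·hi)/C` (`Dfl ≤ (q_c + 3/2)·hi` keeps the window inside `(0, hi]`). -/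
theorem bumpKernel_hflatB {qc : ℝ} (hqc : 4 ≤ qc) (hKd : ∀ e ∈ Icc (-hi) hi, ContDiff ℝ 1 (Kr e)) (hKc0 : Continuous fun p : ℝ × ℝ => Kr p.1 p.2)
    (hKc : Continuous fun p : ℝ × ℝ => deriv (Kr p.1) p.2) (hK0 : ∀ e ∈ Icc (-hi) hi, e ≠ 0 → ∀ u, |Kr e u| ≤ (max |e| |u|)⁻¹)
    {wt : ℝ → ℝ} {W : ℝ} (hwc : ContinuousOn wt (Icc (-hi) hi)) (hwW : ∀ e ∈ Icc (-hi) hi, |wt e| ≤ W) {Afl Bfl Dfl : ℝ} (hDfl' : Dfl ≤ (qc + 3 / 2) * hi)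
    (hflatBχ : ∀ D : ℝ, 0 < D → D ≤ Dfl →
      |∫ e in (max lo (D / (qc + 3 / 2)))..(min hi (4 * D)), (wt e * χ (D - e)) * deriv (Kr e) (D - e)| ≤ Afl * (lo / (max D lo) ^ 2) + Bfl) :
    ∀ D : ℝ, 0 < D → D ≤ Dfl →
      |∫ e in (max lo (D / (qc + 3 / 2)))..(min hi (4 * D)), wt e * deriv (fun v => χ v * Kr e v / C) (D - e)| ≤
        Afl / C * (lo / (max D lo) ^ 2) + (Bfl + W * Bχ₁ * rχ⁻¹ * hi) / C := fun D hD hDfl => by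
  have hχd : Differentiable ℝ χ := hχ.differentiable (by norm_num)
  have hC0 : 0 < C := by linarith
  have hB1 : 0 ≤ Bχ₁ := (abs_nonneg _).trans (hχ1 0)
  have hhi0 : 0 < hi := hlo.trans_le hlohi
  have hW0 : 0 ≤ W := (abs_nonneg _).trans (hwW 0 ⟨by linarith, hhi0.le⟩)
  have hqc0 : 0 < qc + 3 / 2 := by linarith
  set aD : ℝ := max lo (D / (qc + 3 / 2)) with haD
  set bD : ℝ := min hi (4 * D) with hbD
  -- the window lies inside `(0, hi]`
  have haD0 : 0 < aD := lt_max_of_lt_left hlo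
  have haDhi : aD ≤ hi := max_le hlohi (by rw [div_le_iff₀ hqc0, mul_comm]; exact hDfl.trans hDfl')
  have hbD0 : 0 < bD := lt_min hhi0 (by linarith)
  have hbDhi : bD ≤ hi := min_le_left _ _
  have hwin : ∀ e ∈ Ι aD bD, e ∈ Icc (-hi) hi ∧ 0 < e := fun e he => by
    rcases mem_uIoc.1 he with h | h
    · exact ⟨⟨by linarith [h.1], h.2.trans hbDhi⟩, haD0.trans h.1⟩
    · exact ⟨⟨by linarith [h.1], h.2.trans haDhi⟩, hbD0.trans h.1⟩
  have hsub : uIcc aD bD ⊆ Icc (-hi) hi := Set.uIcc_subset_Icc ⟨by linarith, haDhi⟩ ⟨by linarith, hbDhi⟩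
  -- rewrite the integrand
  have hderiv : ∀ e ∈ Ι aD bD, wt e * deriv (fun v => χ v * Kr e v / C) (D - e) =
      C⁻¹ * (wt e * (deriv χ (D - e) * Kr e (D - e))) + C⁻¹ * ((wt e * χ (D - e)) * deriv (Kr e) (D - e)) := fun e he => by
    rw [deriv_bumpKernel hχd ((hKd e (hwin e he).1).differentiable one_ne_zero)]; ring
  rw [intervalIntegral.integral_congr_ae (Eventually.of_forall hderiv)]
  -- continuity on `uIcc aD bD ⊆ [−hi, hi]` ⇒ interval integrability of the two pieces
  have hc1 : ContinuousOn (fun e => wt e * (deriv χ (D - e) * Kr e (D - e))) (Icc (-hi) hi) :=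
    hwc.mul ((((hχ.continuous_deriv (by norm_num)).comp (continuous_const.sub continuous_id)).mul
      (hKc0.comp (continuous_id.prodMk (continuous_const.sub continuous_id)))).continuousOn)
  have hc2 : ContinuousOn (fun e => (wt e * χ (D - e)) * deriv (Kr e) (D - e)) (Icc (-hi) hi) :=
    (hwc.mul (hχ.continuous.comp (continuous_const.sub continuous_id)).continuousOn).mul
      (hKc.comp (continuous_id.prodMk (continuous_const.sub continuous_id))).continuousOn
  have hi1 : IntervalIntegrable (fun e => C⁻¹ * (wt e * (deriv χ (D - e) * Kr e (D - e)))) volume aD bD :=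
    ((hc1.mono hsub).intervalIntegrable).const_mul _
  have hi2 : IntervalIntegrable (fun e => C⁻¹ * ((wt e * χ (D - e)) * deriv (Kr e) (D - e))) volume aD bD :=
    ((hc2.mono hsub).intervalIntegrable).const_mul _
  rw [intervalIntegral.integral_add hi1 hi2, intervalIntegral.integral_const_mul, intervalIntegral.integral_const_mul]
  -- first piece: value envelope on the transition zone, window length ≤ hi
  have hfirst : |∫ e in aD..bD, wt e * (deriv χ (D - e) * Kr e (D - e))| ≤ W * Bχ₁ * rχ⁻¹ * hi := by
    have hb : ∀ e ∈ Ι aD bD, ‖wt e * (deriv χ (D - e) * Kr e (D - e))‖ ≤ W * Bχ₁ * rχ⁻¹ := fun e he => by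
      obtain ⟨he', he0⟩ := hwin e he
      rw [Real.norm_eq_abs, abs_mul, abs_mul]
      by_cases hu : |D - e| ≤ rχ
      · rw [hχ1r _ hu, abs_zero, zero_mul, mul_zero]; positivity
      · push Not at hu
        have hKv : |Kr e (D - e)| ≤ rχ⁻¹ := by
          refine (hK0 e he' he0.ne' (D - e)).trans ?_
          exact inv_anti₀ hrχ (hu.le.trans (le_max_right _ _))
        calc |wt e| * (|deriv χ (D - e)| * |Kr e (D - e)|) ≤ W * (Bχ₁ * rχ⁻¹) :=
              mul_le_mul (hwW e he') (mul_le_mul (hχ1 _) hKv (abs_nonneg _) hB1) (by positivity) hW0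
          _ = W * Bχ₁ * rχ⁻¹ := by ring
    have h := intervalIntegral.norm_integral_le_of_norm_le_const hb
    rw [Real.norm_eq_abs] at h
    have hlen : |bD - aD| ≤ hi := by
      rw [abs_le]; constructor <;> linarith
    calc |∫ e in aD..bD, wt e * (deriv χ (D - e) * Kr e (D - e))| ≤ W * Bχ₁ * rχ⁻¹ * |bD - aD| := h
      _ ≤ W * Bχ₁ * rχ⁻¹ * hi := by gcongr
  have hsecond := hflatBχ D hD hDfl
  have hCinv : 0 < C⁻¹ := inv_pos.2 hC0
  calc |(C⁻¹ * ∫ e in aD..bD, wt e * (deriv χ (D - e) * Kr e (D - e))) + C⁻¹ * ∫ e in aD..bD, (wt e * χ (D - e)) * deriv (Kr e) (D - e)|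
      ≤ C⁻¹ * |∫ e in aD..bD, wt e * (deriv χ (D - e) * Kr e (D - e))| + C⁻¹ * |∫ e in aD..bD, (wt e * χ (D - e)) * deriv (Kr e) (D - e)| := by
        refine (abs_add_le _ _).trans ?_
        rw [abs_mul, abs_mul, abs_of_pos hCinv]
    _ ≤ C⁻¹ * (W * Bχ₁ * rχ⁻¹ * hi) + C⁻¹ * (Afl * (lo / (max D lo) ^ 2) + Bfl) := by gcongr
    _ = Afl / C * (lo / (max D lo) ^ 2) + (Bfl + W * Bχ₁ * rχ⁻¹ * hi) / C := by
        field_simp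
        ring

end Middle

end Summit.HubbardSuperconductivity.HubbardSuperconductivity.Theorems.C4a

end
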